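import Summits.SmoothPoincare4.SmoothPoincare4.Theorems.SymplecticOrigamiOrigamiFoldExistenceStubOuterCleanRecognitionChartCreaseRule
import Summits.SmoothPoincare4.SmoothPoincare4.Theorems.SymplecticOrigamiOrigamiFoldExistenceStubOuterCleanRecognitionChartSeamRule

/-!
# Stub `stub_outerCleanRecognitionChart` of line `shadow-pleats` for crux `OrigamiFoldExistence` — J:
# the sheet-count FORMULA `n_P = 1_B − 1_U` as a claim set, its local constancy and the far region (item stmt-SmoothPoincare4-7844, route SymplecticOrigami; seat c3, S4''-chart worker)

Tenth helper file towards `stub_outerCleanRecognitionChart : OuterCleanRecognitionChart`, over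
files G–I (counting sets `sheet0/1/2` of the outer part, locally constant off `S_ρ ∪ c_out`;
the local rules across the seam sphere and across the outer crease).  The lead's sheet-count
formula (O2)(a), `n_P = 1_{B_ρ} − 1_{U_out}` off `S_ρ ∪ c_out`, is encoded as the CLAIM SET
`claimSet D` (exterior & inside ⇒ one sheet; chimney & inside ⇒ no sheet; exterior & outside ⇒
no sheet; chimney & outside ⇒ impossible), and the set `goodSet D` of points near which the
claim holds off `S_ρ ∪ c_out`.  This file proves the two "easy" thirds of the propagation:

* `claimSet_of_const` — on a set with constant side, constant position w.r.t. `S_ρ` and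
  constant sheet number, the claim is constant; hence (`mem_goodSet_of_mem_closure`) AT A
  POINT OFF `S_ρ ∪ c_out` the good set is closed: a limit of good points is good;
* `exists_far_goodSet` — FAR AWAY every point is good (no sheet: the shadow of the compact
  `P̄⁺` is bounded; exterior: the chimney and the crease are bounded; outside `S_ρ`);
* bookkeeping: `S_ρ ∪ c_out` is closed and nowhere dense (`interior_seam_union_crease`), sides
  and positions are locally constant, crease points are limits of exterior and of chimney points.

**`mem_goodSet_of_mem_closure`** is the registered helper.  File K runs the propagation across
`S_ρ` and `c_out` (the rules of files H–I) and concludes the count.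

Sources: the lead's `OuterClean-analysis-c3.md` §3 (O2)(a)–(b); files G–I.
-/

noncomputable section

-- the prescribed namespace `Summit.<P>.<Sub>.…` duplicates `SmoothPoincare4` (P = Sub)
set_option linter.dupNamespace false

open scoped Manifold ContDiff Topology RealInnerProductSpace
open Set Function Filter Metric
open Literature.Topology.FourManifolds Literature.Topology.FourManifolds.SphereHypersurfaceSides

namespace Summit.SmoothPoincare4.SmoothPoincare4.Theorems.OrigamiFoldExistence.ShadowPleats

/-! ### The claim set and the good set -/

section Claim

variable {M : Type} {ι : M → EuclideanSpace ℝ (Fin 5)} {δ : ℝ} {e : Fin 1 → EuclideanSpace ℝ (Fin 4) → M}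

/-- THE CLAIM SET — the sheet-count formula `n_P = 1_{B_ρ} − 1_{U_out}` pointwise: over the
exterior inside `S_ρ` exactly one sheet, over the chimney inside `S_ρ` none, over the exterior
outside `S_ρ` none, and no chimney point outside `S_ρ`. -/
def claimSet (δ : ℝ) (D : TubeData (liftedCrease ι (e 0))) : Set (EuclideanSpace ℝ (Fin 4)) :=
  {y | (y ∈ exterior4 D → ‖y‖ < Real.sqrt (1 - (1 - δ) ^ 2) → y ∈ sheet1 ι δ (e 0)) ∧
       (y ∈ chimney4 D → ‖y‖ < Real.sqrt (1 - (1 - δ) ^ 2) → y ∈ sheet0 ι δ (e 0)) ∧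
       (y ∈ exterior4 D → Real.sqrt (1 - (1 - δ) ^ 2) < ‖y‖ → y ∈ sheet0 ι δ (e 0)) ∧
       (y ∈ chimney4 D → Real.sqrt (1 - (1 - δ) ^ 2) < ‖y‖ → False)}

/-- THE GOOD SET: points near which the claim holds off `S_ρ ∪ c_out`. -/
def goodSet (δ : ℝ) (D : TubeData (liftedCrease ι (e 0))) : Set (EuclideanSpace ℝ (Fin 4)) :=
  {y | ∃ ε : ℝ, 0 < ε ∧ ∀ z ∈ Metric.ball y ε,
    z ∉ Metric.sphere (0 : EuclideanSpace ℝ (Fin 4)) (Real.sqrt (1 - (1 - δ) ^ 2)) ∪ (proj5 ∘ ι ∘ e 0) '' Metric.sphere 0 2 →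
    z ∈ claimSet δ D}

variable (D : TubeData (liftedCrease ι (e 0)))

/-- The good set is open: a ball of half the radius consists of good points. -/
theorem ball_subset_goodSet {y : EuclideanSpace ℝ (Fin 4)} {ε : ℝ} (hε : 0 < ε)
    (hgood : ∀ z ∈ Metric.ball y ε, z ∉ Metric.sphere (0 : EuclideanSpace ℝ (Fin 4)) (Real.sqrt (1 - (1 - δ) ^ 2)) ∪
      (proj5 ∘ ι ∘ e 0) '' Metric.sphere 0 2 → z ∈ claimSet δ D) :
    Metric.ball y (ε / 2) ⊆ goodSet δ D := fun w hw =>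
  ⟨ε / 2, by positivity, fun v hv hvΩ => hgood v (by
    rw [Metric.mem_ball] at hw hv ⊢
    linarith [dist_triangle v w y]) hvΩ⟩

/-- The good set is open. -/
theorem isOpen_goodSet : IsOpen (goodSet δ D) := by
  rw [Metric.isOpen_iff]
  rintro y ⟨ε, hε, hgood⟩
  exact ⟨ε / 2, by positivity, ball_subset_goodSet D hε hgood⟩

/-- A good point off `S_ρ ∪ c_out` satisfies the claim. -/
theorem mem_claimSet_of_mem_goodSet {y : EuclideanSpace ℝ (Fin 4)} (hy : y ∈ goodSet δ D)
    (hyΩ : y ∉ Metric.sphere (0 : EuclideanSpace ℝ (Fin 4)) (Real.sqrt (1 - (1 - δ) ^ 2)) ∪ (proj5 ∘ ι ∘ e 0) '' Metric.sphere 0 2) :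
    y ∈ claimSet δ D := by
  obtain ⟨ε, hε, hgood⟩ := hy
  exact hgood y (mem_ball_self hε) hyΩ

/-- **The claim is constant on sets of constant type.**  If `B` lies on one side (chimney or
exterior), on one side of `S_ρ` (inside or outside), and in one counting set, and ONE point of
`B` satisfies the claim, then every point of `B` does. -/
theorem claimSet_of_const {B : Set (EuclideanSpace ℝ (Fin 4))}
    (hside : B ⊆ chimney4 D ∨ B ⊆ exterior4 D)
    (hpos : B ⊆ Metric.ball 0 (Real.sqrt (1 - (1 - δ) ^ 2)) ∨ B ⊆ (Metric.closedBall 0 (Real.sqrt (1 - (1 - δ) ^ 2)))ᶜ)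
    (hsheet : B ⊆ sheet0 ι δ (e 0) ∨ B ⊆ sheet1 ι δ (e 0) ∨ B ⊆ sheet2 ι δ (e 0))
    {y' : EuclideanSpace ℝ (Fin 4)} (hy' : y' ∈ B) (hclaim : y' ∈ claimSet δ D) : B ⊆ claimSet δ D := by
  intro z hz
  set ρ := Real.sqrt (1 - (1 - δ) ^ 2) with hρ
  have hdisj := disjoint_chimney4_exterior4 D
  obtain ⟨c1, c2, c3, c4⟩ := hclaim
  -- transport of the type data from `z` to `y'`
  have sideV : z ∈ exterior4 D → y' ∈ exterior4 D := fun hzV => by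
    rcases hside with h | h
    · exact absurd (h hz) fun hzU => Set.disjoint_left.1 hdisj hzU hzV
    · exact h hy'
  have sideU : z ∈ chimney4 D → y' ∈ chimney4 D := fun hzU => by
    rcases hside with h | h
    · exact h hy'
    · exact absurd (h hz) fun hzV => Set.disjoint_left.1 hdisj hzU hzV
  have posIn : ‖z‖ < ρ → ‖y'‖ < ρ := fun hzρ => by
    rcases hpos with h | h
    · exact mem_ball_zero_iff.1 (h hy')
    · exact absurd (mem_closedBall_zero_iff.2 hzρ.le) (h hz)
  have posOut : ρ < ‖z‖ → ρ < ‖y'‖ := fun hzρ => by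
    rcases hpos with h | h
    · exact absurd (mem_ball_zero_iff.1 (h hz)) (not_lt.2 hzρ.le)
    · exact not_le.1 fun hle => h hy' (mem_closedBall_zero_iff.2 hle)
  have sh0 : y' ∈ sheet0 ι δ (e 0) → z ∈ sheet0 ι δ (e 0) := fun h0 => by
    rcases hsheet with h | h | h
    · exact h hz
    · exact absurd (h hy') (not_mem_sheet1_of_mem_sheet0 h0)
    · exact absurd (h hy') (not_mem_sheet2_of_mem_sheet0 h0)
  have sh1 : y' ∈ sheet1 ι δ (e 0) → z ∈ sheet1 ι δ (e 0) := fun h1 => by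
    rcases hsheet with h | h | h
    · exact absurd h1 (not_mem_sheet1_of_mem_sheet0 (h hy'))
    · exact h hz
    · exact absurd (h hy') (not_mem_sheet2_of_mem_sheet1 h1)
  exact ⟨fun hzV hzρ => sh1 (c1 (sideV hzV) (posIn hzρ)), fun hzU hzρ => sh0 (c2 (sideU hzU) (posIn hzρ)),
    fun hzV hzρ => sh0 (c3 (sideV hzV) (posOut hzρ)), fun hzU hzρ => c4 (sideU hzU) (posOut hzρ)⟩

/-! ### Bookkeeping: `S_ρ ∪ c_out` is closed and nowhere dense; types are locally constant -/

include D in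
/-- The outer crease has empty interior (it lifts into the frontier of the open exterior). -/
theorem interior_crease_eq_empty : interior ((proj5 ∘ ι ∘ e 0) '' Metric.sphere (0 : EuclideanSpace ℝ (Fin 4)) 2) = ∅ := by
  have hN := northPole_notMem_range_liftedCrease ι (e 0)
  rw [Set.eq_empty_iff_forall_notMem]
  intro y hy
  obtain ⟨ε, hε, hball⟩ := Metric.isOpen_iff.1 isOpen_interior y hy
  -- the lifted ball is an open subset of the crease = frontier of the exterior: impossible
  have hopen : IsOpen (liftS4 '' Metric.ball y ε) := by
    have h1 : liftS4 '' Metric.ball y ε = (stereographic' 4 northPole).symm '' Metric.ball y ε := rfl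
    rw [h1]
    exact (stereographic' 4 northPole).symm.isOpen_image_of_subset_source isOpen_ball
      (by rw [OpenPartialHomeomorph.symm_source, stereographic'_target]; exact subset_univ _)
  have hsub : liftS4 '' Metric.ball y ε ⊆ frontier (exterior D) := by
    rw [frontier_exterior D hN]
    rintro _ ⟨z, hz, rfl⟩
    exact (liftS4_mem_range_iff z).2 (interior_subset (hball hz))
  have hint : liftS4 '' Metric.ball y ε ⊆ interior (frontier (exterior D)ᶜ) := by
    rw [frontier_compl]
    exact interior_maximal hsub hopen
  -- the interior of the frontier of a closed set is empty
  rw [interior_frontier (isOpen_exterior D hN).isClosed_compl] at hint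
  exact hint ⟨y, mem_ball_self hε, rfl⟩

/-- A connected set missing the crease lies on one side. -/
theorem subset_side_of_isPreconnected {B : Set (EuclideanSpace ℝ (Fin 4))} (hB : IsPreconnected B)
    (hBC : Disjoint B ((proj5 ∘ ι ∘ e 0) '' Metric.sphere 0 2)) (hne : B.Nonempty) :
    B ⊆ chimney4 D ∨ B ⊆ exterior4 D := by
  have hN := northPole_notMem_range_liftedCrease ι (e 0)
  have hpre : IsPreconnected (liftS4 '' B) := hB.image liftS4 contMDiff_liftS4.continuous.continuousOn
  have hdisj : Disjoint (liftS4 '' B) (range (liftedCrease ι (e 0))) := by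
    refine Set.disjoint_left.2 ?_
    rintro _ ⟨z, hz, rfl⟩ hzC
    exact Set.disjoint_left.1 hBC hz ((liftS4_mem_range_iff z).1 hzC)
  obtain ⟨y, hy⟩ := hne
  rcases mem_chimney4_or D y with hyU | hyC | hyV
  · left
    have := subset_chimney_of_isPreconnected D hN hpre hdisj ⟨liftS4 y, mem_image_of_mem _ hy, hyU⟩
    exact fun z hz => this (mem_image_of_mem _ hz)
  · exact absurd hyC (Set.disjoint_left.1 hBC hy)
  · right
    have := subset_exterior_of_isPreconnected D hN hpre hdisj ⟨liftS4 y, mem_image_of_mem _ hy, hyV⟩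
    exact fun z hz => this (mem_image_of_mem _ hz)

/-- A ball missing `S_ρ` lies inside or outside it. -/
theorem ball_subset_pos {y : EuclideanSpace ℝ (Fin 4)} {ε : ℝ}
    (hBS : Disjoint (Metric.ball y ε) (Metric.sphere (0 : EuclideanSpace ℝ (Fin 4)) (Real.sqrt (1 - (1 - δ) ^ 2)))) :
    Metric.ball y ε ⊆ Metric.ball 0 (Real.sqrt (1 - (1 - δ) ^ 2)) ∨
      Metric.ball y ε ⊆ (Metric.closedBall 0 (Real.sqrt (1 - (1 - δ) ^ 2)))ᶜ := by
  set ρ := Real.sqrt (1 - (1 - δ) ^ 2)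
  have hpre : IsPreconnected (Metric.ball y ε) := (convex_ball y ε).isPreconnected
  have hcover : Metric.ball y ε ⊆ Metric.ball 0 ρ ∪ (Metric.closedBall 0 ρ)ᶜ := fun z hz => by
    rcases lt_trichotomy ‖z‖ ρ with hlt | heq | hgt
    · exact Or.inl (mem_ball_zero_iff.2 hlt)
    · exact absurd (mem_sphere_zero_iff_norm.2 heq) (Set.disjoint_left.1 hBS hz)
    · exact Or.inr fun hle => absurd (mem_closedBall_zero_iff.1 hle) (not_le.2 hgt)
  exact hpre.subset_or_subset isOpen_ball isClosed_closedBall.isOpen_compl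
    (Set.disjoint_left.2 fun z hz hz' => hz' (ball_subset_closedBall hz)) hcover

end Claim

section ClaimTop

variable {M : Type} [TopologicalSpace M] [ChartedSpace (EuclideanSpace ℝ (Fin 4)) M]
  {ι : M → EuclideanSpace ℝ (Fin 5)} {δ : ℝ} {e : Fin 1 → EuclideanSpace ℝ (Fin 4) → M}
  (D : TubeData (liftedCrease ι (e 0)))

/-- `S_ρ ∪ c_out` is closed. -/
theorem isClosed_seam_union_crease (h : IsPleatedPosition ι δ e) :
    IsClosed (Metric.sphere (0 : EuclideanSpace ℝ (Fin 4)) (Real.sqrt (1 - (1 - δ) ^ 2)) ∪ (proj5 ∘ ι ∘ e 0) '' Metric.sphere 0 2) :=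
  isClosed_sphere.union (isClosed_crease h)

include D in
/-- `S_ρ ∪ c_out` has empty interior. -/
theorem interior_seam_union_crease (h : IsPleatedPosition ι δ e) :
    interior (Metric.sphere (0 : EuclideanSpace ℝ (Fin 4)) (Real.sqrt (1 - (1 - δ) ^ 2)) ∪ (proj5 ∘ ι ∘ e 0) '' Metric.sphere 0 2) = ∅ := by
  rw [union_comm, interior_union_isClosed_of_interior_empty (isClosed_crease h)
    (interior_sphere' (0 : EuclideanSpace ℝ (Fin 4)) _), interior_crease_eq_empty D]

include D in
/-- A non-empty open set has a point off `S_ρ ∪ c_out`. -/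
theorem exists_mem_notMem_seam_union_crease (h : IsPleatedPosition ι δ e) {O : Set (EuclideanSpace ℝ (Fin 4))} (hO : IsOpen O)
    (hne : O.Nonempty) :
    ∃ z ∈ O, z ∉ Metric.sphere (0 : EuclideanSpace ℝ (Fin 4)) (Real.sqrt (1 - (1 - δ) ^ 2)) ∪ (proj5 ∘ ι ∘ e 0) '' Metric.sphere 0 2 := by
  by_contra hnot
  push Not at hnot
  have : O ⊆ interior (Metric.sphere (0 : EuclideanSpace ℝ (Fin 4)) (Real.sqrt (1 - (1 - δ) ^ 2)) ∪
      (proj5 ∘ ι ∘ e 0) '' Metric.sphere 0 2) := interior_maximal hnot hO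
  rw [interior_seam_union_crease D h] at this
  obtain ⟨z, hz⟩ := hne
  exact this hz

variable [T2Space M] [CompactSpace M] [IsManifold (𝓡 4) ∞ M]

/-- **CLOSEDNESS OF THE GOOD SET AT POINTS OFF `S_ρ ∪ c_out`** (registered helper of file J): a
point off the seam sphere and the outer crease that is a limit of good points is good (the
claim is locally constant there). [folklore] -/
theorem mem_goodSet_of_mem_closure (h : IsPleatedPosition ι δ e) {y : EuclideanSpace ℝ (Fin 4)} (hyΩ : y ∉ Metric.sphere (0 : EuclideanSpace ℝ (Fin 4)) (Real.sqrt (1 - (1 - δ) ^ 2)) ∪ (proj5 ∘ ι ∘ e 0) '' Metric.sphere 0 2) (hcl : y ∈ closure (goodSet δ D)) : y ∈ goodSet δ D := by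
  set ρ := Real.sqrt (1 - (1 - δ) ^ 2) with hρ
  -- a ball around `y` of constant type
  obtain ⟨ε₁, hε₁, hball₁⟩ := Metric.isOpen_iff.1 (isClosed_seam_union_crease h).isOpen_compl y hyΩ
  obtain ⟨ε₂, hε₂, hsh0, hsh1, hsh2⟩ := exists_ball_sheets_const h hyΩ
  set ε := min ε₁ ε₂ with hεdef
  have hε : 0 < ε := lt_min hε₁ hε₂
  have hB₁ : Metric.ball y ε ⊆ Metric.ball y ε₁ := Metric.ball_subset_ball (min_le_left _ _)
  have hB₂ : Metric.ball y ε ⊆ Metric.ball y ε₂ := Metric.ball_subset_ball (min_le_right _ _)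
  have hBΩ : ∀ z ∈ Metric.ball y ε, z ∉ Metric.sphere (0 : EuclideanSpace ℝ (Fin 4)) ρ ∪ (proj5 ∘ ι ∘ e 0) '' Metric.sphere 0 2 :=
    fun z hz => hball₁ (hB₁ hz)
  have hside : Metric.ball y ε ⊆ chimney4 D ∨ Metric.ball y ε ⊆ exterior4 D :=
    subset_side_of_isPreconnected D (convex_ball y ε).isPreconnected
      (Set.disjoint_left.2 fun z hz hzC => hBΩ z hz (Or.inr hzC)) ⟨y, mem_ball_self hε⟩
  have hpos := ball_subset_pos (δ := δ) (Set.disjoint_left.2 fun z hz hzS => hBΩ z hz (Or.inl hzS))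
  have hsheet : Metric.ball y ε ⊆ sheet0 ι δ (e 0) ∨ Metric.ball y ε ⊆ sheet1 ι δ (e 0) ∨ Metric.ball y ε ⊆ sheet2 ι δ (e 0) := by
    rcases mem_sheet0_or (ι := ι) (δ := δ) (e₀ := e 0) y with h0 | h1 | h2
    · exact Or.inl (hB₂.trans (hsh0 h0))
    · exact Or.inr (Or.inl (hB₂.trans (hsh1 h1)))
    · exact Or.inr (Or.inr (hB₂.trans (hsh2 h2)))
  -- a good point in the ball satisfies the claim; transport it
  obtain ⟨y', hy'B, hy'good⟩ := mem_closure_iff.1 hcl (Metric.ball y ε) isOpen_ball (mem_ball_self hε)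
  have hclaim : y' ∈ claimSet δ D := mem_claimSet_of_mem_goodSet D hy'good (hBΩ y' hy'B)
  have hall := claimSet_of_const D hside hpos hsheet hy'B hclaim
  exact ⟨ε, hε, fun z hz _ => hall hz⟩

/-! ### The far region -/

omit [T2Space M] in
/-- **FAR AWAY EVERY POINT IS GOOD**: there is `R ≥ ρ` such that every point of norm `> R` lies
in the exterior, outside `S_ρ`, and carries no sheet — so the claim holds on `{‖y‖ > R}` and
every point of norm `> R + 1` is good. -/
theorem exists_far_goodSet (h : IsPleatedPosition ι δ e) :
    ∃ R : ℝ, Real.sqrt (1 - (1 - δ) ^ 2) ≤ R ∧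
      (∀ y : EuclideanSpace ℝ (Fin 4), R < ‖y‖ → y ∈ exterior4 D ∧ y ∈ sheet0 ι δ (e 0) ∧ y ∈ claimSet δ D) ∧
      ∀ y : EuclideanSpace ℝ (Fin 4), R + 1 < ‖y‖ → y ∈ goodSet δ D := by
  have hN := northPole_notMem_range_liftedCrease ι (e 0)
  set ρ := Real.sqrt (1 - (1 - δ) ^ 2) with hρ
  -- the shadow of the closed outer part is bounded
  obtain ⟨R₁, hR₁⟩ := ((isCompact_outerPartK h).image (contMDiff_shadow h.1).continuous).isBounded.subset_closedBall 0
  -- the chimney and the crease are bounded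
  obtain ⟨R₂, hR₂⟩ := (isBounded_preimage_liftS4_closure_chimney D hN).subset_closedBall 0
  obtain ⟨R₃, hR₃⟩ := ((isCompact_sphere (0 : EuclideanSpace ℝ (Fin 4)) 2).image
    (contDiff_chartShadow h).continuous).isBounded.subset_closedBall 0
  set R := max ρ (max R₁ (max R₂ R₃)) with hR
  have hfar : ∀ y : EuclideanSpace ℝ (Fin 4), R < ‖y‖ → y ∈ exterior4 D ∧ y ∈ sheet0 ι δ (e 0) ∧ y ∈ claimSet δ D := by
    intro y hy
    have hy₁ : R₁ < ‖y‖ := lt_of_le_of_lt (by simp [hR]) hy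
    have hy₂ : R₂ < ‖y‖ := lt_of_le_of_lt (by simp [hR]) hy
    have hy₃ : R₃ < ‖y‖ := lt_of_le_of_lt (by simp [hR]) hy
    have hyρ : ρ < ‖y‖ := lt_of_le_of_lt (by simp [hR]) hy
    have hsh0 : y ∈ sheet0 ι δ (e 0) := mem_sheet0_of_not_mem_shadow fun hmem =>
      absurd (mem_closedBall_zero_iff.1 (hR₁ hmem)) (not_le.2 hy₁)
    have hV : y ∈ exterior4 D := by
      rcases mem_chimney4_or D y with hU | hC | hV
      · exact absurd (mem_closedBall_zero_iff.1 (hR₂ (subset_closure hU))) (not_le.2 hy₂)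
      · exact absurd (mem_closedBall_zero_iff.1 (hR₃ hC)) (not_le.2 hy₃)
      · exact hV
    have hU : y ∉ chimney4 D := fun hU => Set.disjoint_left.1 (disjoint_chimney4_exterior4 D) hU hV
    exact ⟨hV, hsh0, fun _ _ => absurd hyρ (by linarith), fun h' _ => absurd h' hU, fun _ _ => hsh0, fun h' _ => hU h'⟩
  refine ⟨R, le_max_left _ _, hfar, fun y hy => ⟨1, one_pos, fun z hz _ => (hfar z ?_).2.2⟩⟩
  rw [Metric.mem_ball, dist_eq_norm] at hz
  have := norm_sub_norm_le y z
  have h2 : ‖y - z‖ = ‖z - y‖ := norm_sub_rev y z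
  linarith

end ClaimTop

end Summit.SmoothPoincare4.SmoothPoincare4.Theorems.OrigamiFoldExistence.ShadowPleats

end
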